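import Summits.CriticalPhenomena.CardyFormulaZ2.Theorems.CardyBoundaryCoulombGasRectilinearCardyStubClosureJunctionPart1
import HarnessLib

/-!
# Stub D1 `stub_closureJunction` of line `excursion-kernel-covariance`, part 2: from the four
# long-way crossings to an open path of the closure discretisation between the two rows at the
# flat junction (crux `RectilinearCardy`, stmt-CriticalPhenomena-5660, route `CardyBoundaryCoulombGas`)

Port of `mem_discreteCrossing_of_fourCross` / `mem_discreteCrossing_tail_of_fourCross` (mesh
discretisation) to the closure discretisation `V_δ = closureFinset R δ` at a FLAT junction
`b = pt 1` (half-plane case of the wedge):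

* `cjn_mem_openCrossing_of_fourCross` — the four long-way open crossings of the square annulus
  `c + A(l)` around the site `c` nearest to `b` give an open path of the induced graph on `V_δ`
  between boundary-row vertices attributed to the boundary set carrying the start ray and to the
  one carrying the opposite ray: turn the crossings to the standard frame
  (`fourWalks_relabel_quarterTurn_iterate`), build the half-plane walk on the first lattice line
  `⌈Im β⌉` inside `Ω̄` (`exists_sectorWalk_two`) and conclude by `cjn_mem_openCrossing_of_sectorWalk`;
* `cjn_mem_openCrossing_tail_of_fourCross` — specialisation to the arcs at the junction: the rows
  `rowArc R δ` of `(ab) = arc 0` and `rowTail R δ s'` of the tail arc `∂Ω[s', d]`, as soon as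
  `boundary '' [mark 1, s']` stays within `λ` of `b`.
-/

noncomputable section

open Set Filter Topology MeasureTheory Metric
open Literature.Probability.RandomPlanarGeometry
open Literature.Probability.Percolation
open Literature.Probability.LatticeModels (Site zdGraph meshPoint meshDomain meshBoundary discreteArc
  meshVertices)

namespace Summit.CriticalPhenomena.CardyFormulaZ2.Cruxes.RectilinearCardy.ExcursionKernelCovariance

/-- A real number of modulus `≤ 1` has ceiling of modulus `≤ 2` (the row index `⌈Im β⌉` of the
reduced offset `β`, `|β| ≤ 1`, is a threshold admissible for `exists_sectorWalk_two`). [folklore] -/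
theorem cjn_abs_ceil_le_two {x : ℝ} (hx : |x| ≤ 1) : |⌈x⌉| ≤ 2 := by
  have h := abs_le.1 hx
  have h1 : (⌈x⌉ : ℝ) < 2 := by linarith [Int.ceil_lt_add_one x]
  have h2 : (-1 : ℝ) ≤ ⌈x⌉ := by linarith [Int.le_ceil x]
  have h1' : ⌈x⌉ < 2 := by exact_mod_cast h1
  have h2' : -1 ≤ ⌈x⌉ := by exact_mod_cast h2
  rw [abs_le]; omega

/-- **From the four long-way crossings to an open path of `V_δ` between the two rows at a flat
junction.** In the setting of `cjn_mem_openCrossing_of_sectorWalk` (half-plane at `b` in the frame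
`a`, target sets `P₁`, `P₂`, site `c` within `δ` of `b`, scale `l ≥ 3` with `λ ≤ (l - 3)δ`,
`20 l δ ≤ r`): if the lattice configuration `ω` has open left-right crossings of the top and bottom
boxes and open top-bottom crossings of the left and right boxes of the square annulus `c + A(l)`,
then `ω` has an open path of the induced graph on `V_δ` from a boundary-row vertex attributed to
`P₁` to one attributed to `P₂`. Proof: turn the four crossings to the standard frame
(`fourWalks_relabel_quarterTurn_iterate`), build the half-plane walk on the lattice line
`⌈Im β⌉` (`exists_sectorWalk_two`), and apply `cjn_mem_openCrossing_of_sectorWalk`. [folklore] -/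
theorem cjn_mem_openCrossing_of_fourCross (R : ConformalRectangle) {b : ℂ} {r : ℝ} {a : ℕ}
    {A₁ A₂ P₁ P₂ : Set ℂ}
    (hA₁ : ∀ z, dist z b < r → (z ∈ A₁ ↔ ((z - b) * (-Complex.I) ^ a).im = 0 ∧
      0 ≤ ((z - b) * (-Complex.I) ^ a).re))
    (hA₂ : ∀ z, dist z b < r → (z ∈ A₂ ↔ ((z - b) * (-Complex.I) ^ (a + 2)).im = 0 ∧
      0 ≤ ((z - b) * (-Complex.I) ^ (a + 2)).re))
    (hΩ : ∀ z, dist z b < r → (z ∈ R.carrier ↔ 0 < ((z - b) * (-Complex.I) ^ a).im))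
    {lam : ℝ} (hlam : 0 ≤ lam)
    (hP₁ne : (frontier R.carrier \ P₁).Nonempty) (hP₂ne : (frontier R.carrier \ P₂).Nonempty)
    (hP₁a : ∀ z ∈ A₁, lam < dist z b → z ∈ P₁)
    (hP₁b : ∀ z ∈ frontier R.carrier, z ∉ P₁ → dist z b < r → z ∈ A₂ ∨ dist z b ≤ lam)
    (hP₂a : ∀ z ∈ A₂, lam < dist z b → z ∈ P₂)
    (hP₂b : ∀ z ∈ frontier R.carrier, z ∉ P₂ → dist z b < r → z ∈ A₁ ∨ dist z b ≤ lam)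
    {δ : ℝ} (hδ : 0 < δ) {c : Site 2} (hcb : dist (meshPoint δ c) b ≤ δ) {l : ℕ} (hl : 3 ≤ l)
    (hlaml : lam ≤ ((l : ℝ) - 3) * δ) (hfit : 20 * (l : ℝ) * δ ≤ r)
    {ω : BondConfig (Site 2)} (hω : ω ⊆ (zdGraph 2).edgeSet)
    (hcross : ω ∈ lrCrossingAt (c + ![-(3 * l : ℤ), (l : ℤ) + 1]) (6 * l) (2 * l - 1) ∩
        lrCrossingAt (c + ![-(3 * l : ℤ), -(3 * l : ℤ)]) (6 * l) (2 * l - 1) ∩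
        openCrossing ((· + (c + ![-(3 * l : ℤ), -(3 * l : ℤ)])) ''
            (rectangle (2 * l - 1) (6 * l) : Set (Site 2)))
          ((· + (c + ![-(3 * l : ℤ), -(3 * l : ℤ)])) '' (bottomSide (2 * l - 1) (6 * l) : Set (Site 2)))
          ((· + (c + ![-(3 * l : ℤ), -(3 * l : ℤ)])) '' (topSide (2 * l - 1) (6 * l) : Set (Site 2))) ∩
        openCrossing ((· + (c + ![(l : ℤ) + 1, -(3 * l : ℤ)])) ''
            (rectangle (2 * l - 1) (6 * l) : Set (Site 2)))
          ((· + (c + ![(l : ℤ) + 1, -(3 * l : ℤ)])) '' (bottomSide (2 * l - 1) (6 * l) : Set (Site 2)))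
          ((· + (c + ![(l : ℤ) + 1, -(3 * l : ℤ)])) '' (topSide (2 * l - 1) (6 * l) : Set (Site 2)))) :
    ω ∈ openCrossing (↑(closureFinset R δ) : Set (Site 2))
      {v | v ∈ boundaryRow R δ ∧
        infDist (meshPoint δ v) P₁ ≤ infDist (meshPoint δ v) (frontier R.carrier \ P₁)}
      {v | v ∈ boundaryRow R δ ∧
        infDist (meshPoint δ v) P₂ ≤ infDist (meshPoint δ v) (frontier R.carrier \ P₂)} := by
  -- adapted from `mem_discreteCrossing_of_fourCross` (Theorems/…FourCrossCrossing)
  classical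
  have hl1 : 1 ≤ l := by omega
  have hk : ((2 * l - 1 : ℕ) : ℤ) = 2 * l - 1 := by omega
  have h6 : ((6 * l : ℕ) : ℤ) = 6 * l := by push_cast; ring
  -- the four open walks
  obtain ⟨⟨⟨hT, hB⟩, hL⟩, hR⟩ := hcross
  obtain ⟨aT, bT, T, haT, hbT, hTs, hTe⟩ := exists_walk_of_mem_lrCrossingAt hω hT
  obtain ⟨aB, bB, B, haB, hbB, hBs, hBe⟩ := exists_walk_of_mem_lrCrossingAt hω hB
  obtain ⟨aL, bL, L, haL, hbL, hLs, hLe⟩ := exists_walk_of_mem_tbCrossingAt hω hL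
  obtain ⟨aR, bR, Rt, haR, hbR, hRs, hRe⟩ := exists_walk_of_mem_tbCrossingAt hω hR
  simp only [Pi.add_apply, Matrix.cons_val_zero, Matrix.cons_val_one] at haT hbT hTs haB hbB hBs
  simp only [Pi.add_apply, Matrix.cons_val_zero, Matrix.cons_val_one] at haL hbL hLs haR hbR hRs
  rw [hk] at hTs hBs hLs hRs
  rw [h6] at hbT hTs hbB hBs hbL hLs hbR hRs
  have hdatum := fourWalks_relabel_quarterTurn_iterate (c := c) (l := l) a (ω := ω)
    ⟨⟨aT, bT, T, by omega, by omega, fun z hz => by have := hTs z hz; omega, hTe⟩,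
      ⟨aB, bB, B, by omega, by omega, fun z hz => by have := hBs z hz; omega, hBe⟩,
      ⟨aL, bL, L, by omega, by omega, fun z hz => by have := hLs z hz; omega, hLe⟩,
      ⟨aR, bR, Rt, by omega, by omega, fun z hz => by have := hRs z hz; omega, hRe⟩⟩
  obtain ⟨⟨aT', bT', T', haT', hbT', hTs', hTe'⟩, -,
    ⟨aL', bL', L', haL', hbL', hLs', hLe'⟩, ⟨aR', bR', R', haR', hbR', hRs', hRe'⟩⟩ := hdatum
  -- the reduced offset and the threshold `⌈Im β⌉`
  set βδ : ℂ := (b - meshPoint δ c) * (-Complex.I) ^ a with hβδ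
  set β : ℂ := βδ / (δ : ℂ) with hβ
  have hβδn : ‖βδ‖ ≤ δ := by
    rw [hβδ, norm_mul, norm_pow, norm_neg, Complex.norm_I, one_pow, mul_one, ← dist_eq_norm,
      dist_comm]; exact hcb
  have hβn : ‖β‖ ≤ 1 := by
    rw [hβ, norm_div, Complex.norm_real, Real.norm_eq_abs, abs_of_pos hδ, div_le_one hδ]
    exact hβδn
  have hy₀ : |⌈β.im⌉| ≤ 2 := cjn_abs_ceil_le_two ((Complex.abs_im_le_norm β).trans hβn)
  obtain ⟨vE, vX, W₀, hW₀e, hW₀s, hvE, hvX, -⟩ :=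
    exists_sectorWalk_two hl hy₀ T' haT' hbT' hTs' hTe' L' haL' hbL' hLs' hLe' R' haR' hbR' hRs' hRe'
  exact cjn_mem_openCrossing_of_sectorWalk R hA₁ hA₂ hΩ hlam hP₁ne hP₂ne hP₁a hP₁b hP₂a hP₂b hδ hcb
    hl hlaml hfit W₀ hW₀e hW₀s hvE hvX

/-- **One scale at the flat junction: the four long-way crossings force `rowArc ↔ rowTail s'` in
`V_δ`.** In the half-plane at `b = pt 1` (radius `r`, frame `a`, the two arcs `arc 0`, `arc 1`
being the two opposite rays in either order), for a tail arc `∂Ω[s', d] = tailArc R s'` with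
`boundary '' [mark 1, s']` within `λ` of `b`, a site `c` within `δ` of `b`, a scale `l ≥ 3` with
`λ ≤ (l - 3)δ`, `20 l δ ≤ r`: the four long-way open crossings of `c + A(l)` give an open path of
the induced graph on `V_δ` from `rowArc R δ` to `rowTail R δ s'` (`cjn_mem_openCrossing_of_fourCross`
with the target sets `arc 0` and the tail arc, in the order dictated by the frame; a crossing is
symmetric). [folklore] -/
theorem cjn_mem_openCrossing_tail_of_fourCross (R : ConformalRectangle) {r : ℝ} {a : ℕ}
    (hfront : ∀ z, dist z (R.pt 1) < r → z ∈ frontier R.carrier → z ∈ R.arc 0 ∨ z ∈ R.arc 1)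
    (hΩ : ∀ z, dist z (R.pt 1) < r →
      (z ∈ R.carrier ↔ 0 < ((z - R.pt 1) * (-Complex.I) ^ a).im))
    (hrays : (∀ z, dist z (R.pt 1) < r →
          (z ∈ R.arc 0 ↔ ((z - R.pt 1) * (-Complex.I) ^ a).im = 0 ∧
            0 ≤ ((z - R.pt 1) * (-Complex.I) ^ a).re) ∧
          (z ∈ R.arc 1 ↔ ((z - R.pt 1) * (-Complex.I) ^ (a + 2)).im = 0 ∧
            0 ≤ ((z - R.pt 1) * (-Complex.I) ^ (a + 2)).re)) ∨
        (∀ z, dist z (R.pt 1) < r →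
          (z ∈ R.arc 1 ↔ ((z - R.pt 1) * (-Complex.I) ^ a).im = 0 ∧
            0 ≤ ((z - R.pt 1) * (-Complex.I) ^ a).re) ∧
          (z ∈ R.arc 0 ↔ ((z - R.pt 1) * (-Complex.I) ^ (a + 2)).im = 0 ∧
            0 ≤ ((z - R.pt 1) * (-Complex.I) ^ (a + 2)).re)))
    {s' : ℝ} (hs'1 : R.mark 1 ≤ s') {lam : ℝ} (hlam : 0 ≤ lam)
    (hnear : ∀ t ∈ Icc (R.mark 1) s', dist (R.boundary t) (R.pt 1) ≤ lam)
    {δ : ℝ} (hδ : 0 < δ) {c : Site 2} (hcb : dist (meshPoint δ c) (R.pt 1) ≤ δ) {l : ℕ}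
    (hl : 3 ≤ l) (hlaml : lam ≤ ((l : ℝ) - 3) * δ) (hfit : 20 * (l : ℝ) * δ ≤ r)
    {ω : BondConfig (Site 2)} (hω : ω ⊆ (zdGraph 2).edgeSet)
    (hcross : ω ∈ lrCrossingAt (c + ![-(3 * l : ℤ), (l : ℤ) + 1]) (6 * l) (2 * l - 1) ∩
        lrCrossingAt (c + ![-(3 * l : ℤ), -(3 * l : ℤ)]) (6 * l) (2 * l - 1) ∩
        openCrossing ((· + (c + ![-(3 * l : ℤ), -(3 * l : ℤ)])) ''
            (rectangle (2 * l - 1) (6 * l) : Set (Site 2)))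
          ((· + (c + ![-(3 * l : ℤ), -(3 * l : ℤ)])) '' (bottomSide (2 * l - 1) (6 * l) : Set (Site 2)))
          ((· + (c + ![-(3 * l : ℤ), -(3 * l : ℤ)])) '' (topSide (2 * l - 1) (6 * l) : Set (Site 2))) ∩
        openCrossing ((· + (c + ![(l : ℤ) + 1, -(3 * l : ℤ)])) ''
            (rectangle (2 * l - 1) (6 * l) : Set (Site 2)))
          ((· + (c + ![(l : ℤ) + 1, -(3 * l : ℤ)])) '' (bottomSide (2 * l - 1) (6 * l) : Set (Site 2)))
          ((· + (c + ![(l : ℤ) + 1, -(3 * l : ℤ)])) '' (topSide (2 * l - 1) (6 * l) : Set (Site 2)))) :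
    ω ∈ openCrossing (↑(closureFinset R δ) : Set (Site 2)) ↑(rowArc R δ) ↑(rowTail R δ s') := by
  -- adapted from `mem_discreteCrossing_tail_of_fourCross` (Theorems/…TailAtMarkOne)
  set b := R.pt 1 with hb
  set Tl := tailArc R s' with hTl
  obtain ⟨-, -, -, h23, -⟩ := Literature.Probability.Percolation.mark_chain R
  have hfront' : ∀ z ∈ frontier R.carrier, dist z b < r → z ∈ R.arc 0 ∨ z ∈ R.arc 1 :=
    fun z hz hd => hfront z hd hz
  -- the far part of `arc 1` lies on the tail arc, and the rest of `arc 1` is close to `b`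
  have harc1 : ∀ z ∈ R.arc 1, z ∈ Tl ∨ dist z b ≤ lam := by
    rintro z ⟨t, ht, rfl⟩
    rw [R.nextMark_one] at ht
    by_cases hts : s' ≤ t
    · exact Or.inl (mem_image_of_mem _ ⟨hts, ht.2.trans h23.le⟩)
    · exact Or.inr (hnear t ⟨ht.1, (not_le.1 hts).le⟩)
  have hfar : ∀ z ∈ R.arc 1, lam < dist z b → z ∈ Tl := fun z hz hd =>
    (harc1 z hz).resolve_right (not_le.2 hd)
  have hcompl : ∀ z ∈ frontier R.carrier, z ∉ Tl → dist z b < r →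
      z ∈ R.arc 0 ∨ dist z b ≤ lam := by
    intro z hz hzT hd
    rcases hfront' z hz hd with h | h
    · exact Or.inl h
    · exact Or.inr ((harc1 z h).resolve_left hzT)
  have hne0 : (frontier R.carrier \ R.arc 0).Nonempty :=
    ⟨R.pt 2, R.pt_mem_frontier 2, pt_two_notMem_arc_zero R⟩
  have hneT : (frontier R.carrier \ Tl).Nonempty :=
    ⟨R.pt 0, R.pt_mem_frontier 0, pt_zero_not_mem_tailArc R hs'1⟩
  -- the two rows
  have hrowArc : {v | v ∈ boundaryRow R δ ∧ infDist (meshPoint δ v) (R.arc 0) ≤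
      infDist (meshPoint δ v) (frontier R.carrier \ R.arc 0)} = (↑(rowArc R δ) : Set (Site 2)) := by
    ext v
    rw [Set.mem_setOf_eq, Finset.mem_coe, mem_rowArc_iff]
  have hrowTl : {v | v ∈ boundaryRow R δ ∧ infDist (meshPoint δ v) Tl ≤
      infDist (meshPoint δ v) (frontier R.carrier \ Tl)} = (↑(rowTail R δ s') : Set (Site 2)) := by
    ext v
    rw [Set.mem_setOf_eq, Finset.mem_coe, mem_rowTail_iff]
  rcases hrays with h | h
  · -- `arc 0` is the start ray
    have := cjn_mem_openCrossing_of_fourCross R (A₁ := R.arc 0) (A₂ := R.arc 1) (P₁ := R.arc 0)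
      (P₂ := Tl) (fun z hz => (h z hz).1) (fun z hz => (h z hz).2) hΩ hlam hne0 hneT
      (fun z hz _ => hz) (fun z hz hz0 hd => Or.inl ((hfront' z hz hd).resolve_left hz0)) hfar
      hcompl hδ hcb hl hlaml hfit hω hcross
    rwa [hrowArc, hrowTl] at this
  · -- `arc 1` is the start ray: cross from the tail row to the row of `arc 0` and reverse
    obtain ⟨x, hx, y, hy, hxy⟩ := cjn_mem_openCrossing_of_fourCross R (A₁ := R.arc 1)
      (A₂ := R.arc 0) (P₁ := Tl) (P₂ := R.arc 0) (fun z hz => (h z hz).1) (fun z hz => (h z hz).2)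
      hΩ hlam hneT hne0 hfar hcompl (fun z hz _ => hz)
      (fun z hz hz0 hd => Or.inl ((hfront' z hz hd).resolve_left hz0)) hδ hcb hl hlaml hfit hω hcross
    rw [hrowTl] at hx
    rw [hrowArc] at hy
    refine ⟨y, hy, x, hx, ?_⟩
    rw [openConnIn_comm]
    exact hxy

end Summit.CriticalPhenomena.CardyFormulaZ2.Cruxes.RectilinearCardy.ExcursionKernelCovariance

end
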